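import Summits.NavierStokesRegularity.NavierStokesRegularity.Theorems.RellichScarDefs
import Summits.NavierStokesRegularity.NavierStokesRegularity.Theorems.RellichScarScarRigidityApexRegularityExchange
import Literature.Analysis.FluidPDE.TypeIAncientMild
import HarnessLib

/-!
# `ScarRigidity` — line `SketchIdeator6`, stub `stub_zoomOrbitIncrement` (S2b)
# (crux stmt-NavierStokesRegularity-11717, route RellichScar)

**S2b — the zoom orbit of a smooth apex profile is Lipschitz at the profile in the weighted sup norm.**
Let `V` be a Type-I ancient mild field on `(−∞,0) × ℝ³` with the scale-invariant bound package
(`ScaleInvariantBounds V Q`; only the first time derivative at spatial order `0`,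
`‖∂ₜV(t,x)‖ ≤ L/(‖x‖+√(−t))³`, is used) and suppose the spatial dilation generator is flat,
`‖V(t,x) + ∇V(t,x)·x‖ ≤ K(−t)/(‖x‖+√(−t))³`.  Then for `λ ∈ [1/2, 2]`, `t < 0`, `x ∈ ℝ³`,
`‖V_λ(t,x) − V(t,x)‖ ≤ K'|λ−1|(−t)/(‖x‖+√(−t))³`, `V_λ(t,x) = λV(λ²t, λx)` (`nsRescale`), with
`K' = 48·max L 0 + 8·max K 0`.

Proof.  Split `V_λ(t,x) − V(t,x) = λ(V(λ²t,λx) − V(t,λx)) + (λV(t,λx) − V(t,x))`.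
* Time shift: the time line `s ↦ V(s, λx)` is differentiable on `s < 0` with
  `‖∂ₛV(s,λx)‖ ≤ L/(λ‖x‖+√(−s))³ ≤ 8L/(‖x‖+√(−t))³` on the segment between `t` and `λ²t` (there `−s ≥ −t/4`);
  the mean value inequality and `|λ²t − t| ≤ 3|λ−1|(−t)` give `48·L|λ−1|(−t)/(‖x‖+√(−t))³`.
* Spatial dilation: `φ(μ) = μV(t,μx)` has `φ'(μ) = V(t,μx) + ∇V(t,μx)·(μx)`, bounded by
  `K(−t)/(μ‖x‖+√(−t))³ ≤ 8K(−t)/(‖x‖+√(−t))³` for `μ` between `1` and `λ`; the mean value inequality gives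
  `8K|λ−1|(−t)/(‖x‖+√(−t))³`.
Mathlib only (`Convex.norm_image_sub_le_of_norm_hasDerivWithin_le`), plus the tree's exchange lemma
`deriv_iteratedFDeriv_slice` (to read the order-`0` member of the package) and `hasDerivAt_timeLine`.
-/

noncomputable section

open Set Filter Function MeasureTheory Metric TopologicalSpace
open scoped Topology ENNReal NNReal InnerProductSpace RealInnerProductSpace

set_option linter.dupNamespace false

namespace Summit.NavierStokesRegularity.NavierStokesRegularity.Theorems.RellichScarScarRigidity

open Literature.Analysis.FluidPDE

/-- Physical space. -/
local notation "ℝ³" => EuclideanSpace ℝ (Fin 3)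

/-- Weight comparison: if `D/2 ≤ a` with `D > 0` and `c ≥ 0`, then `c/a³ ≤ 8·(c/D³)`. [folklore] -/
private theorem zoomOrbit_div_cube_le {c a D : ℝ} (hc : 0 ≤ c) (hD : 0 < D) (h : D / 2 ≤ a) :
    c / a ^ 3 ≤ 8 * (c / D ^ 3) := by
  have hD2 : 0 < D / 2 := half_pos hD
  calc c / a ^ 3 ≤ c / (D / 2) ^ 3 :=
        div_le_div_of_nonneg_left hc (pow_pos hD2 3) (pow_le_pow_left₀ hD2.le h 3)
    _ = 8 * (c / D ^ 3) := by
        rw [div_pow, div_div_eq_mul_div]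
        ring

/-- **S2b — the zoom orbit of a smooth apex profile is Lipschitz at the profile in the weighted sup norm.**
If `V` is a Type-I ancient mild field with the scale-invariant package and a flat spatial dilation generator,
`‖V(t,x) + ∇V(t,x)·x‖ ≤ K(−t)/(‖x‖+√(−t))³`, then `‖λV(λ²t,λx) − V(t,x)‖ ≤ K'|λ−1|(−t)/(‖x‖+√(−t))³` for
`λ ∈ [1/2,2]` (mean value inequality in the scale parameter, split into a time shift controlled by
`‖∂ₜV‖ ≤ L/(‖x‖+√(−t))³` and a spatial dilation controlled by the generator). [folklore] -/
theorem stub_zoomOrbitIncrement :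
    ∀ (V : ℝ → ℝ³ → ℝ³) (Q : ℝ → ℝ³ → ℝ) (C K : ℝ), 0 < C →
      IsTypeIAncientMild C V → HasTypeIDecay C V → ScaleInvariantBounds V Q →
      (∀ t < 0, ∀ x : ℝ³, ‖V t x + fderiv ℝ (V t) x x‖ ≤ K * ((-t) / (‖x‖ + Real.sqrt (-t)) ^ 3)) →
      ∃ K' : ℝ, ∀ lam ∈ Icc (1 / 2 : ℝ) 2, ∀ t < 0, ∀ x : ℝ³,
        ‖nsRescale lam V t x - V t x‖ ≤ K' * |lam - 1| * ((-t) / (‖x‖ + Real.sqrt (-t)) ^ 3) := by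
  intro V Q C K _hC hm _hd hB hK
  -- joint smoothness and the order-`0` time-derivative bound of the package
  have hsm : IsSmoothSpaceTimeOn (Iio (0 : ℝ)) V := hm.contDiffOn
  obtain ⟨L, hL⟩ := hB 0
  have hdt : ∀ s < (0 : ℝ), ∀ y : ℝ³,
      ‖deriv (fun σ => V σ y) s‖ ≤ L / (‖y‖ + Real.sqrt (-s)) ^ 3 := by
    intro s hs y
    have h := (hL s hs y).2.2
    rw [deriv_iteratedFDeriv_slice hsm isOpen_Iio 0 hs y, norm_iteratedFDeriv_zero] at h
    simpa using h
  refine ⟨48 * max L 0 + 8 * max K 0, fun lam hlam t ht x => ?_⟩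
  obtain ⟨hl1, hl2⟩ := hlam
  have hlam0 : 0 < lam := by linarith
  have hnt : 0 < -t := neg_pos.2 ht
  have hsq : 0 < Real.sqrt (-t) := Real.sqrt_pos.2 hnt
  have hD : 0 < ‖x‖ + Real.sqrt (-t) := add_pos_of_nonneg_of_pos (norm_nonneg _) hsq
  have hL0 : 0 ≤ max L 0 := le_max_right _ _
  have hK0 : 0 ≤ max K 0 := le_max_right _ _
  have hw : 0 ≤ (-t) / (‖x‖ + Real.sqrt (-t)) ^ 3 := div_nonneg hnt.le (pow_nonneg hD.le 3)
  /- (A) the time shift at the point `lam • x` -/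
  have hy : ‖lam • x‖ = lam * ‖x‖ := by rw [norm_smul, Real.norm_eq_abs, abs_of_pos hlam0]
  have hseg : ∀ s ∈ uIcc t (lam ^ 2 * t), s ≤ t / 4 := by
    intro s hs
    rcases mem_uIcc.1 hs with ⟨_, h2⟩ | ⟨_, h2⟩
    · nlinarith [mul_nonneg (mul_nonneg (sub_nonneg.2 hl1) (by linarith : (0 : ℝ) ≤ lam + 1 / 2)) hnt.le]
    · linarith
  have hderivA : ∀ s ∈ uIcc t (lam ^ 2 * t), HasDerivWithinAt (fun σ => V σ (lam • x))
      (deriv (fun σ => V σ (lam • x)) s) (uIcc t (lam ^ 2 * t)) s := by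
    intro s hs
    have hs0 : s < 0 := by linarith [hseg s hs]
    exact (hsm.hasDerivAt_timeLine isOpen_Iio hs0 (lam • x)).hasDerivWithinAt
  have hboundA : ∀ s ∈ uIcc t (lam ^ 2 * t),
      ‖deriv (fun σ => V σ (lam • x)) s‖ ≤ 8 * (max L 0 / (‖x‖ + Real.sqrt (-t)) ^ 3) := by
    intro s hs
    have hs4 := hseg s hs
    have hs0 : s < 0 := by linarith
    have h1 : Real.sqrt (-t) / 2 ≤ Real.sqrt (-s) := by
      rw [Real.le_sqrt (by positivity) (by linarith)]
      nlinarith [Real.sq_sqrt hnt.le]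
    have h2 : ‖x‖ / 2 ≤ ‖lam • x‖ := by
      rw [hy]
      nlinarith [norm_nonneg x]
    have hden : (‖x‖ + Real.sqrt (-t)) / 2 ≤ ‖lam • x‖ + Real.sqrt (-s) := by linarith
    calc ‖deriv (fun σ => V σ (lam • x)) s‖ ≤ L / (‖lam • x‖ + Real.sqrt (-s)) ^ 3 := hdt s hs0 _
      _ ≤ max L 0 / (‖lam • x‖ + Real.sqrt (-s)) ^ 3 :=
          div_le_div_of_nonneg_right (le_max_left _ _) (by positivity)
      _ ≤ 8 * (max L 0 / (‖x‖ + Real.sqrt (-t)) ^ 3) := zoomOrbit_div_cube_le hL0 hD hden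
  have hmvtA : ‖V (lam ^ 2 * t) (lam • x) - V t (lam • x)‖ ≤
      8 * (max L 0 / (‖x‖ + Real.sqrt (-t)) ^ 3) * ‖lam ^ 2 * t - t‖ :=
    (convex_uIcc t (lam ^ 2 * t)).norm_image_sub_le_of_norm_hasDerivWithin_le hderivA hboundA
      left_mem_uIcc right_mem_uIcc
  have hnormt : ‖lam ^ 2 * t - t‖ ≤ 3 * |lam - 1| * (-t) := by
    rw [Real.norm_eq_abs, show lam ^ 2 * t - t = (lam + 1) * ((lam - 1) * t) by ring, abs_mul, abs_mul,
      abs_of_neg ht, abs_of_pos (by linarith : (0 : ℝ) < lam + 1)]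
    have h3 : lam + 1 ≤ 3 := by linarith
    calc (lam + 1) * (|lam - 1| * -t) ≤ 3 * (|lam - 1| * -t) :=
          mul_le_mul_of_nonneg_right h3 (mul_nonneg (abs_nonneg _) hnt.le)
      _ = 3 * |lam - 1| * -t := by ring
  have hA : ‖lam • (V (lam ^ 2 * t) (lam • x) - V t (lam • x))‖ ≤
      48 * max L 0 * |lam - 1| * ((-t) / (‖x‖ + Real.sqrt (-t)) ^ 3) := by
    rw [norm_smul, Real.norm_eq_abs, abs_of_pos hlam0]
    have hC0 : 0 ≤ 8 * (max L 0 / (‖x‖ + Real.sqrt (-t)) ^ 3) := by positivity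
    have hnn : 0 ≤ 8 * (max L 0 / (‖x‖ + Real.sqrt (-t)) ^ 3) * (3 * |lam - 1| * (-t)) := by positivity
    have h := hmvtA.trans (mul_le_mul_of_nonneg_left hnormt hC0)
    calc lam * ‖V (lam ^ 2 * t) (lam • x) - V t (lam • x)‖
        ≤ lam * (8 * (max L 0 / (‖x‖ + Real.sqrt (-t)) ^ 3) * (3 * |lam - 1| * (-t))) :=
          mul_le_mul_of_nonneg_left h hlam0.le
      _ ≤ 2 * (8 * (max L 0 / (‖x‖ + Real.sqrt (-t)) ^ 3) * (3 * |lam - 1| * (-t))) :=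
          mul_le_mul_of_nonneg_right hl2 hnn
      _ = 48 * max L 0 * |lam - 1| * ((-t) / (‖x‖ + Real.sqrt (-t)) ^ 3) := by ring
  /- (B) the spatial dilation at the time `t` -/
  have hVt : Differentiable ℝ (V t) := (hm.contDiff_slice ht).differentiable (by simp)
  have hderivB : ∀ μ ∈ uIcc 1 lam, HasDerivWithinAt (fun μ : ℝ => μ • V t (μ • x))
      (V t (μ • x) + fderiv ℝ (V t) (μ • x) (μ • x)) (uIcc 1 lam) μ := by
    intro μ _
    have h1 : HasDerivAt (fun ν : ℝ => ν • x) x μ := by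
      simpa using (hasDerivAt_id μ).smul_const x
    have h2 : HasDerivAt (fun ν : ℝ => V t (ν • x)) (fderiv ℝ (V t) (μ • x) x) μ :=
      (hVt (μ • x)).hasFDerivAt.comp_hasDerivAt μ h1
    have h3 : HasDerivAt (fun ν : ℝ => ν • V t (ν • x))
        (μ • fderiv ℝ (V t) (μ • x) x + (1 : ℝ) • V t (μ • x)) μ := (hasDerivAt_id' μ).smul h2
    refine (h3.congr_deriv ?_).hasDerivWithinAt
    rw [(fderiv ℝ (V t) (μ • x)).map_smul, one_smul, add_comm]
  have hboundB : ∀ μ ∈ uIcc 1 lam, ‖V t (μ • x) + fderiv ℝ (V t) (μ • x) (μ • x)‖ ≤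
      max K 0 * (8 * ((-t) / (‖x‖ + Real.sqrt (-t)) ^ 3)) := by
    intro μ hμ
    have hμ1 : 1 / 2 ≤ μ := by
      rcases mem_uIcc.1 hμ with ⟨h1, _⟩ | ⟨h1, _⟩ <;> linarith
    have hμ0 : 0 < μ := by linarith
    have hnμ : ‖μ • x‖ = μ * ‖x‖ := by rw [norm_smul, Real.norm_eq_abs, abs_of_pos hμ0]
    have hden : (‖x‖ + Real.sqrt (-t)) / 2 ≤ ‖μ • x‖ + Real.sqrt (-t) := by
      rw [hnμ]
      nlinarith [mul_nonneg (sub_nonneg.2 hμ1) (norm_nonneg x), hsq.le]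
    calc ‖V t (μ • x) + fderiv ℝ (V t) (μ • x) (μ • x)‖
        ≤ K * ((-t) / (‖μ • x‖ + Real.sqrt (-t)) ^ 3) := hK t ht (μ • x)
      _ ≤ max K 0 * ((-t) / (‖μ • x‖ + Real.sqrt (-t)) ^ 3) :=
          mul_le_mul_of_nonneg_right (le_max_left _ _) (by positivity)
      _ ≤ max K 0 * (8 * ((-t) / (‖x‖ + Real.sqrt (-t)) ^ 3)) :=
          mul_le_mul_of_nonneg_left (zoomOrbit_div_cube_le hnt.le hD hden) hK0
  have hmvtB := (convex_uIcc (1 : ℝ) lam).norm_image_sub_le_of_norm_hasDerivWithin_le hderivB hboundB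
      left_mem_uIcc right_mem_uIcc
  have hB' : ‖lam • V t (lam • x) - V t x‖ ≤
      8 * max K 0 * |lam - 1| * ((-t) / (‖x‖ + Real.sqrt (-t)) ^ 3) := by
    rw [one_smul, one_smul, Real.norm_eq_abs] at hmvtB
    calc ‖lam • V t (lam • x) - V t x‖
        ≤ max K 0 * (8 * ((-t) / (‖x‖ + Real.sqrt (-t)) ^ 3)) * |lam - 1| := hmvtB
      _ = 8 * max K 0 * |lam - 1| * ((-t) / (‖x‖ + Real.sqrt (-t)) ^ 3) := by ring
  /- assembling -/
  have hsplit : nsRescale lam V t x - V t x =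
      lam • (V (lam ^ 2 * t) (lam • x) - V t (lam • x)) + (lam • V t (lam • x) - V t x) := by
    rw [nsRescale_apply, smul_sub]
    abel
  rw [hsplit]
  calc ‖lam • (V (lam ^ 2 * t) (lam • x) - V t (lam • x)) + (lam • V t (lam • x) - V t x)‖
      ≤ ‖lam • (V (lam ^ 2 * t) (lam • x) - V t (lam • x))‖ + ‖lam • V t (lam • x) - V t x‖ :=
        norm_add_le _ _
    _ ≤ 48 * max L 0 * |lam - 1| * ((-t) / (‖x‖ + Real.sqrt (-t)) ^ 3) +
          8 * max K 0 * |lam - 1| * ((-t) / (‖x‖ + Real.sqrt (-t)) ^ 3) := add_le_add hA hB'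
    _ = (48 * max L 0 + 8 * max K 0) * |lam - 1| * ((-t) / (‖x‖ + Real.sqrt (-t)) ^ 3) := by ring

end Summit.NavierStokesRegularity.NavierStokesRegularity.Theorems.RellichScarScarRigidity

end
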